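import Summits.CriticalPhenomena.PercolationContinuityZ3.Theorems.PercNearOneGluingNoHeavyLowerTailDualBHKSep
import HarnessLib

/-!
# Dual BHK inequality — the events under peeling: pointwise translations, locality, monotonicity, degenerate cases

Support file 4/7 for the dual BHK inequality `u_b·u_c ≥ t·n′_a` (memo `prim-ineq-gen-2/DUAL-BHK.md` §8, Lemma P;
`--supports stmt-CriticalPhenomena-4575`).  For a configuration `S` (open set `S ∪ F`), a universe `U ∋ v` with `a ≠ v` and
`K = Kset U (S ∪ F) v` the open neighbours of `v`, `A^K := (A ∖ {v}) ∪ K`: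
* `t(M,X) ↔ t′(M, X^K)` for `v ∈ X ∖ M` (`mem_evT_peel_iff`), and the mirror `v ∈ M ∖ X`;
* `Ξ(A;Z) ↔ Ξ′(A; Z^K)` for `v ∈ Z ∖ A` (`mem_evXi_peel_avoid_iff`);  `Ξ(W;B) ↔ Ξ′(W^K; B)` for `v ∈ W ∖ B`
  (`mem_evXi_peel_hub_iff`);  `e₄(W;M) ↔ e₄′(W^K; M)` for `v ∈ W ∖ M`;
* `q⁺(Av;P,Q) ↔ q⁺′(Av^K; P, (Q ∖ v) ∪ D_v)` for `v ∈ Av ∩ Q ∖ P` (and the mirror), `e₂(M;Y,N) ↔ e₂′(M; Y^K, (N ∖ v) ∪ D_v)`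
  for `v ∈ Y ∩ N ∖ M`, with `D_v = Kset U E v` the support neighbours;
where primes mean the universe `U.erase v`.  Also: the primed events ignore the edges at `v` (locality, for `ad_step`),
(anti)monotonicity in the set parameters, and the degenerate vanishing cases (`a` avoided; a vertex of `P ∩ Q` avoided).
[this work]
-/

namespace Summit.CriticalPhenomena.PercolationContinuityZ3.Theorems

namespace DualBHK

open SimpleGraph

variable {V : Type*}

/-! ### Small structure-graph facts -/

section Small

variable {U : Finset V} {O : Finset (Sym2 V)} {a : V}

/-- Dropping an unused second hub: if the `A`-glued class of `a` misses `B`, gluing `B` as well does not change it.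
[this work] -/
theorem reach_two_hubs_iff_of_miss {A B : Set V} (hB : ∀ m ∈ B, ¬ (sG U O A ∅).Reachable a m) (y : V) :
    (sG U O A B).Reachable a y ↔ (sG U O A ∅).Reachable a y := by
  have hG : sG U O A B = sG U O A ∅ ⊔ gl B := by
    simp only [sG, gl_empty, sup_bot_eq]
  constructor
  · intro h
    rw [hG] at h
    exact reach_of_sup_gl_of_forall_not h hB
  · exact fun h => h.mono (sG_mono_right U O A (Set.empty_subset B))

/-- Dropping an unused first hub. [this work] -/
theorem reach_hub_iff_of_miss {A : Set V} (hA : ∀ m ∈ A, ¬ (sG U O ∅ ∅).Reachable a m) (y : V) :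
    (sG U O A ∅).Reachable a y ↔ (sG U O ∅ ∅).Reachable a y := by
  rw [sG_comm U O A ∅]
  exact reach_two_hubs_iff_of_miss hA y

/-- The glued class of `a` meets the hub `A` iff the plain cluster does. [this work] -/
theorem hits_hub_iff_hits_plain (A B : Set V) :
    (∃ m ∈ A, (sG U O A B).Reachable a m) ↔ ∃ m ∈ A, (sG U O ∅ B).Reachable a m := by
  constructor
  · rintro ⟨m, hm, h⟩
    by_contra hne
    push Not at hne
    rw [sG_comm] at h
    have h' := (reach_two_hubs_iff_of_miss (U := U) (O := O) (A := B) (B := A) (a := a) ?_ m).1 h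
    · rw [sG_comm] at h'
      exact hne m hm h'
    · intro m' hm' hr
      rw [sG_comm] at hr
      exact hne m' hm' hr
  · rintro ⟨m, hm, h⟩
    exact ⟨m, hm, h.mono (sG_mono_left U O (Set.empty_subset A) B)⟩

end Small

variable [DecidableEq V]

/-! ### Locality: the events on `U.erase v` ignore the edges at `v` -/

section Local

variable {U : Finset V} {E F : Finset (Sym2 V)} {a v : V} {T : Finset (Sym2 V)}

/-- `t′` ignores star edges. [this work] -/
theorem union_mem_evT_erase_iff (hT : ∀ e ∈ T, v ∈ e) (R : Finset (Sym2 V)) (M X : Set V) :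
    T ∪ R ∈ evT (U.erase v) F a M X ↔ R ∈ evT (U.erase v) F a M X := by
  simp only [mem_evT, Finset.union_assoc, sG_union_star_eq (Finset.notMem_erase v U) hT]

/-- `Ξ′` ignores star edges. [this work] -/
theorem union_mem_evXi_erase_iff (hT : ∀ e ∈ T, v ∈ e) (R : Finset (Sym2 V)) (A Z : Set V) :
    T ∪ R ∈ evXi (U.erase v) F a A Z ↔ R ∈ evXi (U.erase v) F a A Z := by
  simp only [mem_evXi, Finset.union_assoc, sG_union_star_eq (Finset.notMem_erase v U) hT]

/-- `q⁺′` ignores star edges. [this work] -/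
theorem union_mem_evQp_erase_iff (hT : ∀ e ∈ T, v ∈ e) (R : Finset (Sym2 V)) (Av P Q : Set V) :
    T ∪ R ∈ evQp (U.erase v) E F a Av P Q ↔ R ∈ evQp (U.erase v) E F a Av P Q := by
  simp only [mem_evQp, Finset.union_assoc, sG_union_star_eq (Finset.notMem_erase v U) hT,
    union_star_mem_sepEv_iff (Finset.notMem_erase v U) hT]

/-- `e₂′` ignores star edges. [this work] -/
theorem union_mem_evE2_erase_iff (hT : ∀ e ∈ T, v ∈ e) (R : Finset (Sym2 V)) (M Y N : Set V) :
    T ∪ R ∈ evE2 (U.erase v) E F a M Y N ↔ R ∈ evE2 (U.erase v) E F a M Y N := by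
  simp only [mem_evE2, Finset.union_assoc, sG_union_star_eq (Finset.notMem_erase v U) hT,
    union_star_mem_sepEv_iff (Finset.notMem_erase v U) hT]

/-- `e₄′` ignores star edges. [this work] -/
theorem union_mem_evE4_erase_iff (hT : ∀ e ∈ T, v ∈ e) (R : Finset (Sym2 V)) (W M : Set V) :
    T ∪ R ∈ evE4 (U.erase v) F a W M ↔ R ∈ evE4 (U.erase v) F a W M := by
  simp only [mem_evE4, Finset.union_assoc, sG_union_star_eq (Finset.notMem_erase v U) hT]

end Local

/-! ### Pointwise peeling translations (memo Lemma P) -/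

section Peel

variable {U : Finset V} {E F : Finset (Sym2 V)} {a v : V} {S : Finset (Sym2 V)}

/-- **`t(M,X) ↔ t′(M, X^K)`** for `v ∈ X ∖ M`. [this work] -/
theorem mem_evT_peel_iff (hv : v ∈ U) (hav : a ≠ v) {M X : Set V} (hvX : v ∈ X) (hvM : v ∉ M) :
    S ∈ evT U F a M X ↔ S ∈ evT (U.erase v) F a M ((X \ {v}) ∪ Kset U (S ∪ F) v) := by
  simp only [mem_evT]
  rw [sG_comm U, sG_comm (U.erase v)]
  have h1 : (∃ m ∈ M, (sG U (S ∪ F) X M).Reachable a m) ↔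
      ∃ m ∈ M, (sG (U.erase v) (S ∪ F) ((X \ {v}) ∪ Kset U (S ∪ F) v) M).Reachable a m := by
    constructor
    · rintro ⟨m, hm, h⟩
      exact ⟨m, hm, (reach_peelHub_iff hv hvX hvM hav (fun h' => hvM (h' ▸ hm))).1 h⟩
    · rintro ⟨m, hm, h⟩
      exact ⟨m, hm, (reach_peelHub_iff hv hvX hvM hav (fun h' => hvM (h' ▸ hm))).2 h⟩
  rw [h1, hits_peelHub_iff hv hvX hvM hav]

/-- **`t(M,X) ↔ t′(M^K, X)`** for `v ∈ M ∖ X` (mirror). [this work] -/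
theorem mem_evT_peel_iff_left (hv : v ∈ U) (hav : a ≠ v) {M X : Set V} (hvM : v ∈ M) (hvX : v ∉ X) :
    S ∈ evT U F a M X ↔ S ∈ evT (U.erase v) F a ((M \ {v}) ∪ Kset U (S ∪ F) v) X := by
  simp only [mem_evT]
  have h1 : (∃ x ∈ X, (sG U (S ∪ F) M X).Reachable a x) ↔
      ∃ x ∈ X, (sG (U.erase v) (S ∪ F) ((M \ {v}) ∪ Kset U (S ∪ F) v) X).Reachable a x := by
    constructor
    · rintro ⟨x, hx, h⟩
      exact ⟨x, hx, (reach_peelHub_iff hv hvM hvX hav (fun h' => hvX (h' ▸ hx))).1 h⟩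
    · rintro ⟨x, hx, h⟩
      exact ⟨x, hx, (reach_peelHub_iff hv hvM hvX hav (fun h' => hvX (h' ▸ hx))).2 h⟩
  rw [h1, hits_peelHub_iff hv hvM hvX hav]

/-- **`Ξ(W;B) ↔ Ξ′(W^K; B)`** for `v ∈ W ∖ B` (peeled vertex in the hub). [this work] -/
theorem mem_evXi_peel_hub_iff (hv : v ∈ U) (hav : a ≠ v) {W B : Set V} (hvW : v ∈ W) (hvB : v ∉ B) :
    S ∈ evXi U F a W B ↔ S ∈ evXi (U.erase v) F a ((W \ {v}) ∪ Kset U (S ∪ F) v) B := by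
  simp only [mem_evXi]
  have hve : v ∉ (∅ : Set V) := fun h => h
  rw [hits_peelHub_iff hv hvW hve hav]
  have h2 : (∀ z ∈ B, ¬ (sG U (S ∪ F) W ∅).Reachable a z) ↔
      ∀ z ∈ B, ¬ (sG (U.erase v) (S ∪ F) ((W \ {v}) ∪ Kset U (S ∪ F) v) ∅).Reachable a z := by
    constructor
    · intro h z hz h'
      exact h z hz ((reach_peelHub_iff hv hvW hve hav (fun h'' => hvB (h'' ▸ hz))).2 h')
    · intro h z hz h'
      exact h z hz ((reach_peelHub_iff hv hvW hve hav (fun h'' => hvB (h'' ▸ hz))).1 h')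
  rw [h2]

/-- **`e₄(W;M) ↔ e₄′(W^K; M)`** for `v ∈ W ∖ M`. [this work] -/
theorem mem_evE4_peel_iff (hv : v ∈ U) (hav : a ≠ v) {W M : Set V} (hvW : v ∈ W) (hvM : v ∉ M) :
    S ∈ evE4 U F a W M ↔ S ∈ evE4 (U.erase v) F a ((W \ {v}) ∪ Kset U (S ∪ F) v) M := by
  simp only [mem_evE4]
  have hve : v ∉ (∅ : Set V) := fun h => h
  rw [hits_peelHub_iff hv hvW hve hav]
  have h2 : (∃ m ∈ M, (sG U (S ∪ F) W ∅).Reachable a m) ↔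
      ∃ m ∈ M, (sG (U.erase v) (S ∪ F) ((W \ {v}) ∪ Kset U (S ∪ F) v) ∅).Reachable a m := by
    constructor
    · rintro ⟨m, hm, h⟩
      exact ⟨m, hm, (reach_peelHub_iff hv hvW hve hav (fun h' => hvM (h' ▸ hm))).1 h⟩
    · rintro ⟨m, hm, h⟩
      exact ⟨m, hm, (reach_peelHub_iff hv hvW hve hav (fun h' => hvM (h' ▸ hm))).2 h⟩
  rw [h2]

/-- **`Ξ(A;Z) ↔ Ξ′(A; Z^K)`** for `v ∈ Z ∖ A` (peeled vertex avoided). [this work] -/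
theorem mem_evXi_peel_avoid_iff (hv : v ∈ U) (hav : a ≠ v) {A Z : Set V} (hvZ : v ∈ Z) (hvA : v ∉ A) :
    S ∈ evXi U F a A Z ↔ S ∈ evXi (U.erase v) F a A ((Z \ {v}) ∪ Kset U (S ∪ F) v) := by
  simp only [mem_evXi]
  have hve : v ∉ (∅ : Set V) := fun h => h
  constructor
  · rintro ⟨hA, hZ⟩
    have hK : ∀ k ∈ Kset U (S ∪ F) v, ¬ (sG (U.erase v) (S ∪ F) A ∅).Reachable a k :=
      (not_reach_v_iff_peelAvoid hv hvA hve hav).1 (hZ v hvZ)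
    have hC := reach_iff_peelAvoid hvA hve hav hK
    refine ⟨?_, ?_⟩
    · obtain ⟨m, hm, h⟩ := hA
      exact ⟨m, hm, (hC m).1 h⟩
    · rintro z (⟨hzZ, _⟩ | hzK)
      · exact fun h => hZ z hzZ ((hC z).2 h)
      · exact hK z hzK
  · rintro ⟨hA, hZ⟩
    have hK : ∀ k ∈ Kset U (S ∪ F) v, ¬ (sG (U.erase v) (S ∪ F) A ∅).Reachable a k :=
      fun k hk => hZ k (Or.inr hk)
    have hC := reach_iff_peelAvoid hvA hve hav hK
    refine ⟨?_, fun z hz => ?_⟩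
    · obtain ⟨m, hm, h⟩ := hA
      exact ⟨m, hm, (hC m).2 h⟩
    · by_cases hzv : z = v
      · subst hzv
        exact (not_reach_v_iff_peelAvoid hv hvA hve hav).2 hK
      · exact fun h => hZ z (Or.inl ⟨hz, hzv⟩) ((hC z).1 h)

/-- **`q⁺(Av;P,Q) ↔ q⁺′(Av^K; P, (Q ∖ v) ∪ D_v)`** for `v ∈ Av ∩ Q`, `v ∉ P`. [this work] -/
theorem mem_evQp_peel_iff (hv : v ∈ U) (hav : a ≠ v) {Av P Q : Set V} (hvAv : v ∈ Av) (hvP : v ∉ P)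
    (hvQ : v ∈ Q) :
    S ∈ evQp U E F a Av P Q ↔
      S ∈ evQp (U.erase v) E F a ((Av \ {v}) ∪ Kset U (S ∪ F) v) P ((Q \ {v}) ∪ Kset U E v) := by
  simp only [mem_evQp]
  have hve : v ∉ (∅ : Set V) := fun h => h
  constructor
  · rintro ⟨hAv, hsep⟩
    have hK : ∀ k ∈ Kset U (S ∪ F) v, ¬ (sG (U.erase v) (S ∪ F) ∅ ∅).Reachable a k :=
      (not_reach_v_iff_peelAvoid hv hve hve hav).1 (hAv v hvAv)
    have hC := reach_iff_peelAvoid hve hve hav hK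
    refine ⟨?_, (mem_sepEv_peel_iff hv hvP hvQ hav hK).1 hsep⟩
    rintro z (⟨hz, _⟩ | hzK)
    · exact fun h => hAv z hz ((hC z).2 h)
    · exact hK z hzK
  · rintro ⟨hAv, hsep⟩
    have hK : ∀ k ∈ Kset U (S ∪ F) v, ¬ (sG (U.erase v) (S ∪ F) ∅ ∅).Reachable a k :=
      fun k hk => hAv k (Or.inr hk)
    have hC := reach_iff_peelAvoid hve hve hav hK
    refine ⟨fun z hz => ?_, (mem_sepEv_peel_iff hv hvP hvQ hav hK).2 hsep⟩
    by_cases hzv : z = v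
    · subst hzv
      exact (not_reach_v_iff_peelAvoid hv hve hve hav).2 hK
    · exact fun h => hAv z (Or.inl ⟨hz, hzv⟩) ((hC z).1 h)

/-- **`q⁺(Av;P,Q) ↔ q⁺′(Av^K; (P ∖ v) ∪ D_v, Q)`** for `v ∈ Av ∩ P`, `v ∉ Q` (mirror). [this work] -/
theorem mem_evQp_peel_iff_left (hv : v ∈ U) (hav : a ≠ v) {Av P Q : Set V} (hvAv : v ∈ Av) (hvP : v ∈ P)
    (hvQ : v ∉ Q) :
    S ∈ evQp U E F a Av P Q ↔
      S ∈ evQp (U.erase v) E F a ((Av \ {v}) ∪ Kset U (S ∪ F) v) ((P \ {v}) ∪ Kset U E v) Q := by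
  simp only [mem_evQp]
  have hve : v ∉ (∅ : Set V) := fun h => h
  constructor
  · rintro ⟨hAv, hsep⟩
    have hK : ∀ k ∈ Kset U (S ∪ F) v, ¬ (sG (U.erase v) (S ∪ F) ∅ ∅).Reachable a k :=
      (not_reach_v_iff_peelAvoid hv hve hve hav).1 (hAv v hvAv)
    have hC := reach_iff_peelAvoid hve hve hav hK
    refine ⟨?_, (mem_sepEv_peel_iff_left hv hvP hvQ hav hK).1 hsep⟩
    rintro z (⟨hz, _⟩ | hzK)
    · exact fun h => hAv z hz ((hC z).2 h)
    · exact hK z hzK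
  · rintro ⟨hAv, hsep⟩
    have hK : ∀ k ∈ Kset U (S ∪ F) v, ¬ (sG (U.erase v) (S ∪ F) ∅ ∅).Reachable a k :=
      fun k hk => hAv k (Or.inr hk)
    have hC := reach_iff_peelAvoid hve hve hav hK
    refine ⟨fun z hz => ?_, (mem_sepEv_peel_iff_left hv hvP hvQ hav hK).2 hsep⟩
    by_cases hzv : z = v
    · subst hzv
      exact (not_reach_v_iff_peelAvoid hv hve hve hav).2 hK
    · exact fun h => hAv z (Or.inl ⟨hz, hzv⟩) ((hC z).1 h)

/-- **`e₂(M;Y,N) ↔ e₂′(M; Y^K, (N ∖ v) ∪ D_v)`** for `v ∈ Y ∩ N`, `v ∉ M`. [this work] -/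
theorem mem_evE2_peel_iff (hv : v ∈ U) (hav : a ≠ v) {M Y N : Set V} (hvY : v ∈ Y) (hvM : v ∉ M)
    (hvN : v ∈ N) :
    S ∈ evE2 U E F a M Y N ↔
      S ∈ evE2 (U.erase v) E F a M ((Y \ {v}) ∪ Kset U (S ∪ F) v) ((N \ {v}) ∪ Kset U E v) := by
  simp only [mem_evE2]
  have hve : v ∉ (∅ : Set V) := fun h => h
  constructor
  · rintro ⟨hM, hY, hsep⟩
    have hK : ∀ k ∈ Kset U (S ∪ F) v, ¬ (sG (U.erase v) (S ∪ F) ∅ ∅).Reachable a k :=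
      (not_reach_v_iff_peelAvoid hv hve hve hav).1 (hY v hvY)
    have hC := reach_iff_peelAvoid hve hve hav hK
    refine ⟨?_, ?_, (mem_sepEv_peel_iff hv hvM hvN hav hK).1 hsep⟩
    · obtain ⟨m, hm, h⟩ := hM
      exact ⟨m, hm, (hC m).1 h⟩
    · rintro z (⟨hz, _⟩ | hzK)
      · exact fun h => hY z hz ((hC z).2 h)
      · exact hK z hzK
  · rintro ⟨hM, hY, hsep⟩
    have hK : ∀ k ∈ Kset U (S ∪ F) v, ¬ (sG (U.erase v) (S ∪ F) ∅ ∅).Reachable a k :=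
      fun k hk => hY k (Or.inr hk)
    have hC := reach_iff_peelAvoid hve hve hav hK
    refine ⟨?_, fun z hz => ?_, (mem_sepEv_peel_iff hv hvM hvN hav hK).2 hsep⟩
    · obtain ⟨m, hm, h⟩ := hM
      exact ⟨m, hm, (hC m).2 h⟩
    · by_cases hzv : z = v
      · subst hzv
        exact (not_reach_v_iff_peelAvoid hv hve hve hav).2 hK
      · exact fun h => hY z (Or.inl ⟨hz, hzv⟩) ((hC z).1 h)

end Peel

/-! ### Monotonicity and degenerate cases -/

section Mono

variable {U : Finset V} {E F : Finset (Sym2 V)} {a : V}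

/-- `Ξ(A;·)` is antitone in the avoided set. [this work] -/
theorem evXi_anti {A Z Z' : Set V} (h : Z ⊆ Z') : evXi U F a A Z' ⊆ evXi U F a A Z :=
  fun _ hS => ⟨hS.1, fun z hz => hS.2 z (h hz)⟩

/-- `Ξ(·;∅)` (`= h(·)`) is monotone in the hub. [this work] -/
theorem evXi_empty_mono {A A' : Set V} (h : A ⊆ A') : evXi U F a A ∅ ⊆ evXi U F a A' ∅ := by
  intro S hS
  refine ⟨?_, fun z hz => hz.elim⟩
  obtain ⟨m, hm, hr⟩ := hS.1
  exact ⟨m, h hm, hr.mono (sG_mono_left U (S ∪ F) h ∅)⟩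

/-- `e₄(·;M)` is monotone in the hub. [this work] -/
theorem evE4_mono {W W' M : Set V} (h : W ⊆ W') : evE4 U F a W M ⊆ evE4 U F a W' M := by
  intro S hS
  obtain ⟨⟨w, hw, hr⟩, ⟨m, hm, hr'⟩⟩ := hS
  exact ⟨⟨w, h hw, hr.mono (sG_mono_left U (S ∪ F) h ∅)⟩, ⟨m, hm, hr'.mono (sG_mono_left U (S ∪ F) h ∅)⟩⟩

/-- `q⁺` is antitone in all three sets. [this work] -/
theorem evQp_anti {Av Av' P P' Q Q' : Set V} (hA : Av ⊆ Av') (hP : P ⊆ P') (hQ : Q ⊆ Q') :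
    evQp U E F a Av' P' Q' ⊆ evQp U E F a Av P Q :=
  fun _ hS => ⟨fun z hz => hS.1 z (hA hz), sepEv_anti hP hQ hS.2⟩

/-- `e₂(M;·,·)` is antitone in the avoided set and the separated set. [this work] -/
theorem evE2_anti {M Y Y' N N' : Set V} (hY : Y ⊆ Y') (hN : N ⊆ N') :
    evE2 U E F a M Y' N' ⊆ evE2 U E F a M Y N :=
  fun _ hS => ⟨hS.1, fun z hz => hS.2.1 z (hY hz), sepEv_anti le_rfl hN hS.2.2⟩

/-- Degenerate case: `a` avoided ⇒ `q⁺ = ∅`. [this work] -/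
theorem not_mem_evQp_of_mem {Av P Q : Set V} (ha : a ∈ Av) (S : Finset (Sym2 V)) : S ∉ evQp U E F a Av P Q :=
  fun h => h.1 a ha (Reachable.refl _)

/-- Degenerate case: a vertex of `P ∩ Q` avoided ⇒ `q⁺ = ∅` (the trivial path forces it into the cluster). [this work] -/
theorem not_mem_evQp_of_mem_inter {Av P Q : Set V} {u : V} (hu : u ∈ Av) (huP : u ∈ P) (huQ : u ∈ Q)
    (S : Finset (Sym2 V)) : S ∉ evQp U E F a Av P Q :=
  fun h => h.1 u hu (reach_of_mem_sepEv_of_mem h.2 huP huQ)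

/-- Degenerate case: `a` avoided ⇒ `e₂ = ∅`. [this work] -/
theorem not_mem_evE2_of_mem {M Y N : Set V} (ha : a ∈ Y) (S : Finset (Sym2 V)) : S ∉ evE2 U E F a M Y N :=
  fun h => h.2.1 a ha (Reachable.refl _)

/-- Degenerate case: a vertex of `M ∩ N` avoided ⇒ `e₂ = ∅`. [this work] -/
theorem not_mem_evE2_of_mem_inter {M Y N : Set V} {u : V} (hu : u ∈ Y) (huM : u ∈ M) (huN : u ∈ N)
    (S : Finset (Sym2 V)) : S ∉ evE2 U E F a M Y N :=
  fun h => h.2.1 u hu (reach_of_mem_sepEv_of_mem h.2.2 huM huN)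

end Mono

end DualBHK

end Summit.CriticalPhenomena.PercolationContinuityZ3.Theorems
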